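import Literature.NumberTheory.Irrationality.Fischler2002.Theoreme32CriterionProofs
import HarnessLib

/-!
# Fischler 2002, Théorème 3.2 — brick VIII: the second six-orbit of linear forms and the criterion cone (`n ≥ 5`)

Topic `Literature/NumberTheory/Irrationality/Fischler2002`. PROOFS ONLY (no definition, no statement, no discharge): toward the two remaining
clauses of the named fact `theoreme32` (`RhinViolaGroupsGeneral.lean`) for `n ≥ 5`. On `𝓔` the group `⟨σ, ψ, φ⟩` permutes a SECOND six-set of
linear forms `u₀ = b₃, u₁ = −a₁+a₂+b₃, u₂ = a₁+a₂−a₃, u₃ = b_{n−1}, u₄ = a_{n−3}−a_n+b_{n−2}, u₅ = a_{n−3}+b_{n−2}−b_n` through `σ ↦ (1 2)`,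
`ψ ↦ (0 3)(1 4)(2 5)`, `φ ↦ (3 5)` (`relU_sigma/psi/phi`, using the relations of `𝓔`); every generator maps the CONE
`K = {a_k ≥ 0 (1 ≤ k ≤ n), b₂ ≥ 0, b_n ≥ 0, b_k ≥ 0 (4 ≤ k ≤ n−2)}` into itself (`cone_of_mem`), and for a point of `𝓔 ∩ K` Fischler's finiteness
criterion is just `b₃ ≥ 0 ∧ b_{n−1} ≥ 0` (`crit_iff_of_cone`; brick VI). Hence along the orbit of a criterion point `p`, the point `hp` satisfies
the criterion iff the two orbit-2 forms landing on `b₃` and `b_{n−1}` are non-negative at `p` — the input of the routing brick VII. The forms ride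
on a FREE function symbol `U` with its defining table. Cell `pub-zeta5`, seat ct-1 g33, 2026-08-28.
[cite: Fischler2002Polyzetas, §3 Théorème 3.2] [cite: Fischler2003RhinViola, §3.3 Théorème 5]

HONEST FRAMING (cell pub-zeta5): systematic search; no irrationality claim — integer bookkeeping of printed maps; nothing about `ζ(5)`.
-/

namespace Literature.NumberTheory.Irrationality.Fischler2002

namespace Theoreme32

open Equiv

section OrbitTwo

variable {n : ℕ} {U : Fin 6 → Exponents → ℤ}
  (hU : ∀ (x : Fin 6) (p : Exponents), U x p = ![p.b 3, -p.a 1 + p.a 2 + p.b 3, p.a 1 + p.a 2 - p.a 3, p.b (n - 1),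
    p.a (n - 3) - p.a n + p.b (n - 2), p.a (n - 3) + p.b (n - 2) - p.b n] x)
  {gσ gψ gφ : Perm {p : Exponents // InE n p}}

/-! ### The action of the generators on the second six-orbit -/

include hU in
/-- `σ` acts on the second orbit through `(1 2)` (uses `a₂ = b₁`, `a₁ + b₂ = a₃ + b₃`). [cite: Fischler2002Polyzetas, §3 Théorème 3.2] -/
theorem relU_sigma (hn : 5 ≤ n) (hσ : ∀ p, (gσ p).1 = sigma p.1) (x : Fin 6) (p : {p : Exponents // InE n p}) :
    U x (gσ p).1 = U ((swap (1 : Fin 6) 2) x) p.1 := by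
  obtain ⟨-, -, h4⟩ := p.2
  obtain ⟨h21, -, hch⟩ := h4 (by omega)
  have c1 := hch 1 le_rfl (by omega)
  rw [hσ p]
  rcases (show n = 5 ∨ 6 ≤ n by omega) with rfl | h6
  · fin_cases x <;> simp [hU, sigma, Equiv.swap_apply_def, h21] <;> linarith
  · have e1 : n - 3 ≠ 1 := by omega
    have e2 : n - 3 ≠ 2 := by omega
    have e3 : n - 2 ≠ 1 := by omega
    have e4 : n - 2 ≠ 2 := by omega
    have e5 : n - 1 ≠ 1 := by omega
    have e6 : n - 1 ≠ 2 := by omega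
    have e7 : n ≠ 1 := by omega
    have e8 : n ≠ 2 := by omega
    fin_cases x <;> simp [hU, sigma, Equiv.swap_apply_def, e1, e2, e3, e4, e5, e6, e7, e8] <;> linarith

include hU in
/-- `φ` acts on the second orbit through `(3 5)` (uses `b_n = c_n` and the chain relation at `k = n−3`).
[cite: Fischler2002Polyzetas, §3 Théorème 3.2] -/
theorem relU_phi (hn : 5 ≤ n) (hφ : ∀ p, (gφ p).1 = phi n p.1) (x : Fin 6) (p : {p : Exponents // InE n p}) :
    U x (gφ p).1 = U ((swap (3 : Fin 6) 5) x) p.1 := by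
  obtain ⟨-, -, h4⟩ := p.2
  obtain ⟨-, hbn, hch⟩ := h4 (by omega)
  have c3 := hch (n - 3) (by omega) (by omega)
  rw [show n - 3 + 1 = n - 2 by omega, show n - 3 + 2 = n - 1 by omega] at c3
  rw [hφ p]
  have e1 : (1 : ℕ) ≠ n - 1 := by omega
  have e2 : (2 : ℕ) ≠ n - 1 := by omega
  have e3 : (3 : ℕ) ≠ n - 1 := by omega
  have e3' : (3 : ℕ) ≠ n := by omega
  have e4 : n - 3 ≠ n - 1 := by omega
  have e5 : n ≠ n - 1 := by omega
  have e6 : n - 2 ≠ n - 1 := by omega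
  have e7 : n - 2 ≠ n := by omega
  fin_cases x <;> simp [hU, phi, Equiv.swap_apply_def, e1, e2, e3, e3', e4, e5, e6, e7] <;> linarith

include hU in
/-- `ψ` acts on the second orbit through `(0 3)(1 4)(2 5)` (uses `a₂ = b₁`, `b_n = c_n` and the chain relations at
`k = 1, 2, n−3, n−2`). [cite: Fischler2002Polyzetas, §3 Théorème 3.2] -/
theorem relU_psi (hn : 5 ≤ n) (hψ : ∀ p, (gψ p).1 = psi n p.1) (x : Fin 6) (p : {p : Exponents // InE n p}) :
    U x (gψ p).1 = U ((swap (0 : Fin 6) 3 * swap (1 : Fin 6) 4 * swap (2 : Fin 6) 5) x) p.1 := by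
  obtain ⟨-, -, h4⟩ := p.2
  obtain ⟨h21, hbn, hch⟩ := h4 (by omega)
  have c1 := hch 1 le_rfl (by omega)
  have c2 := hch 2 (by norm_num) (by omega)
  have c3 := hch (n - 3) (by omega) (by omega)
  have c4 := hch (n - 2) (by omega) (by omega)
  rw [show n - 3 + 1 = n - 2 by omega, show n - 3 + 2 = n - 1 by omega] at c3
  rw [show n - 2 + 1 = n - 1 by omega, show n - 2 + 2 = n by omega] at c4
  rw [hψ p]
  have i1 : 1 ≤ 1 ∧ 1 ≤ n := ⟨le_rfl, by omega⟩
  have i2 : 1 ≤ 2 ∧ 2 ≤ n := ⟨by norm_num, by omega⟩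
  have i3 : 1 ≤ 3 ∧ 3 ≤ n := ⟨by norm_num, by omega⟩
  have i4 : 1 ≤ n - 3 ∧ n - 3 ≤ n := ⟨by omega, by omega⟩
  have j3 : 2 ≤ 3 ∧ 3 ≤ n := ⟨by norm_num, by omega⟩
  have j4 : 2 ≤ n - 1 ∧ n - 1 ≤ n := ⟨by omega, by omega⟩
  have j5 : 2 ≤ n - 2 ∧ n - 2 ≤ n := ⟨by omega, by omega⟩
  have e1 : n + 1 - 1 = n := by omega
  have e2 : n + 1 - 2 = n - 1 := by omega
  have e3 : n + 1 - 3 = n - 2 := by omega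
  have e4 : n + 1 - (n - 3) = 4 := by omega
  have e5 : n + 1 - n = 1 := by omega
  have e6 : n + 2 - 3 = n - 1 := by omega
  have e7 : n + 2 - (n - 1) = 3 := by omega
  have e8 : n + 2 - (n - 2) = 4 := by omega
  have e9 : n + 2 - n = 2 := by omega
  have k1 : (3 : ℕ) ≠ 1 := by norm_num
  have k2 : n - 1 ≠ 1 := by omega
  have k3 : n - 2 ≠ 1 := by omega
  have k4 : n ≠ 1 := by omega
  fin_cases x <;>
    simp [hU, psi, Equiv.swap_apply_def, i1, i2, i3, i4, j3, j4, j5, e1, e2, e3, e4, e5, e6, e7, e8, e9, k1, k2, k3, k4] <;>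
    linarith

/-- Products for the second-orbit relation (an anti-homomorphism). [cite: Fischler2002Polyzetas, §3 Théorème 3.2] -/
theorem relU_mul {g h : Perm {p : Exponents // InE n p}} {π τ : Perm (Fin 6)}
    (hg : ∀ x p, U x (g p).1 = U (π x) p.1) (hh : ∀ x p, U x (h p).1 = U (τ x) p.1) :
    ∀ x p, U x ((g * h) p).1 = U ((τ * π) x) p.1 := by
  intro x p
  rw [Perm.mul_apply, hg, hh, Perm.mul_apply]

/-- Inverses for the second-orbit relation. [cite: Fischler2002Polyzetas, §3 Théorème 3.2] -/
theorem relU_inv {g : Perm {p : Exponents // InE n p}} {π : Perm (Fin 6)} (hg : ∀ x p, U x (g p).1 = U (π x) p.1) :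
    ∀ x p, U x (g⁻¹ p).1 = U (π⁻¹ x) p.1 := by
  intro x p
  have h := hg (π⁻¹ x) (g⁻¹ p)
  simp only [Perm.coe_inv, Equiv.apply_symm_apply] at h ⊢
  exact h.symm

/-! ### The cone `K` and the criterion -/

/-- **Every element of `⟨σ', ψ', φ'⟩` (`n ≥ 5`) maps the cone `K = {a_k ≥ 0 (1 ≤ k ≤ n), b₂ ≥ 0, b_n ≥ 0, b_k ≥ 0 (4 ≤ k ≤ n−2)}`
into itself** (σ: `a'₁ = b₂`, `a'₂ = b₁ = a₂`, `b'₂ = a₁`; ψ: reversal, `b'₂ = b_n`, `b'_n = b₂`, `b'_k = b_{n+2−k}`; φ: `a'_{n−1} = c_n = b_n`,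
`b'_n = a_{n−1}`). [cite: Fischler2002Polyzetas, §3 Théorème 3.2] -/
theorem cone_of_mem (hn : 5 ≤ n) (hσ : ∀ p, (gσ p).1 = sigma p.1) (hψ : ∀ p, (gψ p).1 = psi n p.1)
    (hφ : ∀ p, (gφ p).1 = phi n p.1) {g : Perm {p : Exponents // InE n p}}
    (hg : g ∈ Subgroup.closure ({gσ, gψ, gφ} : Set (Perm {p : Exponents // InE n p}))) :
    ∀ p : {p : Exponents // InE n p},
      ((∀ k ∈ Finset.Icc 1 n, 0 ≤ p.1.a k) ∧ 0 ≤ p.1.b 2 ∧ 0 ≤ p.1.b n ∧ ∀ k, 4 ≤ k → k ≤ n - 2 → 0 ≤ p.1.b k) →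
      ((∀ k ∈ Finset.Icc 1 n, 0 ≤ (g p).1.a k) ∧ 0 ≤ (g p).1.b 2 ∧ 0 ≤ (g p).1.b n ∧
        ∀ k, 4 ≤ k → k ≤ n - 2 → 0 ≤ (g p).1.b k) := by
  -- one generator step
  have step : ∀ x ∈ ({gσ, gψ, gφ} : Set (Perm {p : Exponents // InE n p})), ∀ p : {p : Exponents // InE n p},
      ((∀ k ∈ Finset.Icc 1 n, 0 ≤ p.1.a k) ∧ 0 ≤ p.1.b 2 ∧ 0 ≤ p.1.b n ∧ ∀ k, 4 ≤ k → k ≤ n - 2 → 0 ≤ p.1.b k) →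
      ((∀ k ∈ Finset.Icc 1 n, 0 ≤ (x p).1.a k) ∧ 0 ≤ (x p).1.b 2 ∧ 0 ≤ (x p).1.b n ∧
        ∀ k, 4 ≤ k → k ≤ n - 2 → 0 ≤ (x p).1.b k) := by
    intro x hx p ⟨ha, hb2, hbn', hbm⟩
    obtain ⟨-, -, h4⟩ := p.2
    obtain ⟨h21, hbn, -⟩ := h4 (by omega)
    have ha2 : 0 ≤ p.1.a 2 := ha 2 (Finset.mem_Icc.2 ⟨by norm_num, by omega⟩)
    have ha1 : 0 ≤ p.1.a 1 := ha 1 (Finset.mem_Icc.2 ⟨le_rfl, by omega⟩)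
    have ham : 0 ≤ p.1.a (n - 1) := ha (n - 1) (Finset.mem_Icc.2 ⟨by omega, by omega⟩)
    simp only [Set.mem_insert_iff, Set.mem_singleton_iff] at hx
    rcases hx with rfl | rfl | rfl
    · rw [hσ p]
      refine ⟨fun k hk => ?_, by simpa [sigma] using ha1, by simpa [sigma, show n ≠ 1 by omega, show n ≠ 2 by omega] using hbn',
        fun k hk4 hkn => by simpa [sigma, show k ≠ 1 by omega, show k ≠ 2 by omega] using hbm k hk4 hkn⟩
      have hk' := Finset.mem_Icc.1 hk
      by_cases h1 : k = 1
      · subst h1; simpa [sigma] using hb2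
      · by_cases h2 : k = 2
        · subst h2; simpa [sigma, ← h21] using ha2
        · simpa [sigma, h1, h2] using ha k hk
    · rw [hψ p]
      refine ⟨fun k hk => ?_, ?_, ?_, fun k hk4 hkn => ?_⟩
      · have hk' := Finset.mem_Icc.1 hk
        simpa [psi, show 1 ≤ k ∧ k ≤ n from ⟨hk'.1, hk'.2⟩] using ha (n + 1 - k) (Finset.mem_Icc.2 ⟨by omega, by omega⟩)
      · simpa [psi, show (2 : ℕ) ≤ n by omega, show n + 2 - 2 = n by omega] using hbn'
      · simpa [psi, show n ≠ 1 by omega, show (2 : ℕ) ≤ n by omega, show n + 2 - n = 2 by omega] using hb2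
      · simpa [psi, show k ≠ 1 by omega, show 2 ≤ k ∧ k ≤ n from ⟨by omega, by omega⟩] using
          hbm (n + 2 - k) (by omega) (by omega)
    · rw [hφ p]
      refine ⟨fun k hk => ?_, by simpa [phi, show (2 : ℕ) ≠ n - 1 by omega, show (2 : ℕ) ≠ n by omega] using hb2, ?_,
        fun k hk4 hkn => by simpa [phi, show k ≠ n - 1 by omega, show k ≠ n by omega] using hbm k hk4 hkn⟩
      · by_cases hk1 : k = n - 1
        · subst hk1; simpa [phi, ← hbn] using hbn'
        · simpa [phi, hk1] using ha k hk
      · have : 0 ≤ p.1.a (n - 1) + p.1.b n - p.1.c n := by rw [← hbn]; linarith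
        simpa [phi, show n ≠ n - 1 by omega] using this
  have hinvs : ∀ x ∈ ({gσ, gψ, gφ} : Set (Perm {p : Exponents // InE n p})), x⁻¹ = x := by
    intro x hx
    simp only [Set.mem_insert_iff, Set.mem_singleton_iff] at hx
    rcases hx with rfl | rfl | rfl
    · exact inv_eq_of_mul_eq_one_right (perm_sigma_mul_self hσ)
    · exact inv_eq_of_mul_eq_one_right (perm_psi_mul_self (by omega) hψ)
    · exact inv_eq_of_mul_eq_one_right (perm_phi_mul_self (by omega) hφ)
  induction hg using Subgroup.closure_induction_left with
  | one => intro p hp; simpa using hp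
  | mul_left x hx y _ ih =>
    intro p hp
    rw [Perm.mul_apply]
    exact step x hx _ (ih p hp)
  | inv_mul_cancel x hx y _ ih =>
    intro p hp
    rw [Perm.mul_apply, hinvs x hx]
    exact step x hx _ (ih p hp)

/-- **In the cone, the criterion is `b₃ ≥ 0 ∧ b_{n−1} ≥ 0`** (`n ≥ 5`, `p ∈ 𝓔`; brick VI's `crit_iff_nonneg_of_InE` and `b₁ = a₂`).
[cite: Fischler2002Polyzetas, §3 p. 4 (critère) and Théorème 3.2] -/
theorem crit_iff_of_cone (hn : 5 ≤ n) {q : Exponents} (hq : InE n q)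
    (hK : (∀ k ∈ Finset.Icc 1 n, 0 ≤ q.a k) ∧ 0 ≤ q.b 2 ∧ 0 ≤ q.b n ∧ ∀ k, 4 ≤ k → k ≤ n - 2 → 0 ≤ q.b k) :
    FinitenessCriterionGen n q ↔ 0 ≤ q.b 3 ∧ 0 ≤ q.b (n - 1) := by
  obtain ⟨ha, hb2, hbn, hbm⟩ := hK
  obtain ⟨h21, -, -⟩ := hq.2.2 (by omega)
  rw [crit_iff_nonneg_of_InE (by omega) hq]
  refine ⟨fun h => ⟨h.2 3 (Finset.mem_Icc.2 ⟨by norm_num, by omega⟩), h.2 (n - 1) (Finset.mem_Icc.2 ⟨by omega, by omega⟩)⟩,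
    fun ⟨h3, hm⟩ => ⟨ha, fun k hk => ?_⟩⟩
  have hk' := Finset.mem_Icc.1 hk
  by_cases k1 : k = 1
  · subst k1; rw [← h21]; exact ha 2 (Finset.mem_Icc.2 ⟨by norm_num, by omega⟩)
  by_cases k2 : k = 2
  · subst k2; exact hb2
  by_cases k3 : k = 3
  · subst k3; exact h3
  by_cases km : k = n - 1
  · subst km; exact hm
  by_cases kn : k = n
  · subst kn; exact hbn
  exact hbm k (by omega) (by omega)

end OrbitTwo

end Theoreme32

end Literature.NumberTheory.Irrationality.Fischler2002
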